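import Literature.AlgebraicGeometry.Resolution.AlterationsSemiStableResolution
import Literature.AlgebraicGeometry.Resolution.BlowupsComposition
import HarnessLib

/-!
# Making a normal crossings divisor strict by blowing up (de Jong 1996, 2.4): the induction

Topic: `Literature/AlgebraicGeometry/Resolution`. First layer of the decomposition of the named
fact `DeJong1996NormalCrossingsBlowup` (`AlterationsSemiStableResolution.lean`; de Jong 1996, 2.4,
p. 55: "In this case there exists a blowing up `φ : S' → S` in an ideal with support in `D` such
that the reduced inverse image `φ⁻¹(D)_red` is a divisor with strict normal crossings on `S'`.
(In case `S` is a surface, blow up the singular points of `D`; in case `S` is a threefold, first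
blow up the points where `D` has three branches, then blow up the strict transform of the curves
on `S` where `D` has two branches, etc.)"). The source prints no proof beyond this parenthetical
recipe; this file sets up the induction that the recipe describes and PROVES that it yields the
fact, isolating the geometry of one round of blowing up as a named fact to be discharged in
sibling files.

* `branchOrder X Z x : ℕ∞` — the order at `x` of the ideal sheaf of the reduced closed subscheme
  carried by `closure Z` (`idealOrder` of `MarkedIdeals.lean` applied to Mathlib's
  `Scheme.IdealSheafData.vanishingIdeal`). For a normal crossings divisor `Z` and `x ∈ Z` this is
  the number of (geometric) branches of `Z` at `x`: étale-locally `Z = V(x₁ ⋯ x_r)` with `xᵢ` part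
  of a regular system of parameters, and `ord(x₁ ⋯ x_r) = r`; the order of an ideal is invariant
  under étale local homomorphisms. API: `one_le_branchOrder_iff` (`≥ 1` exactly on `closure Z`),
  `branchOrder_eq_zero` (off `closure Z`).
* `NormalCrossingsBranchOrderLe` — NAMED FACT (folklore): at a point of a normal crossings
  divisor the number of branches is at most `dim 𝒪_{S,s}`.
* `DeJong1996NormalCrossingsBlowupStep` — NAMED FACT: ONE ROUND of de Jong's recipe, phrased with
  a "marked part". Data: a normal crossings divisor `Z`, a closed `F ⊆ Z` which is already a
  STRICT normal crossings divisor (the exceptional divisors created so far together with the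
  strict transforms of earlier marked components), and `m` such that every point of `Z` lies on
  at most `m + 1` branches of `Z` not accounted for by `F` (`branchOrder Z ≤ branchOrder F + (m+1)`).
  Conclusion: after blowing up `S` in an ideal supported in `Z` — namely the reduced closed
  subscheme `C = {s | branchOrder Z s = branchOrder F s + m + 1}` of points with the maximal
  number `m + 1` of unmarked branches, which is regular of codimension `m + 1` and étale-locally a
  coordinate subspace `V(x₁, …, x_{m+1})` of `Z = V(x₁ ⋯ x_r)` — the preimage `Z₁` of `Z` is again
  a normal crossings divisor, it contains a strict normal crossings divisor `F₁` (the preimage of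
  `F ∪ C`: old marked components and the new exceptional divisor), and every point of `Z₁` lies on
  at most `m` branches not accounted for by `F₁`. For `dim S = 2, 3` and `F = ∅` initially, the
  successive centres are exactly those of the parenthetical sentence of 2.4 (the points with three
  branches; then the strict transform of the double curve, which is the locus of points with two
  unmarked branches of the transform; …).
* PROVED: `DeJong1996NormalCrossingsBlowup.of_branchOrderLe_of_step` — the two facts imply
  `DeJong1996NormalCrossingsBlowup`: start with `F = ∅` and `m + 1 = d + 1 > dim S ≥` number of
  branches (`NormalCrossingsBranchOrderLe`, `ringKrullDim_stalk_le_topologicalKrullDim`), apply the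
  step `d + 1` times — each source is again Noetherian (`isNoetherian_of_isBlowup`: blow-ups of
  locally Noetherian schemes are proper, `IsBlowup.isProper`) and a composite of two blow-ups of
  a Noetherian scheme with centres in `Z` resp. its preimage is a blow-up with centre in `Z`
  (`IsBlowup.exists_isBlowup_comp_supported`, Raynaud / Stacks 080B, `BlowupsComposition.lean`) —
  and end with `m = 0`, where `branchOrder Z ≤ branchOrder F` forces `Z = F`
  (`eq_of_subset_of_branchOrder_le`), a strict normal crossings divisor.

## Sources

* A. J. de Jong, *Smoothness, semi-stability and alterations*, Publ. Math. IHÉS 83 (1996) 51–93,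
  2.4 (p. 55). [DeJong1996]
* The Stacks Project, Tag 0BI9 (strict normal crossings, local form), Tag 080B (composition of
  blowing ups). [StacksProject]

## Design notes

The decreasing invariant is NOT the maximal number of branches (blowing up a point where `m`
branches meet creates, on the exceptional divisor, new points where `m` branches meet), but the
maximal number of branches outside an already strict part `F`, which absorbs each new exceptional
divisor; at `m = 0` nothing is left to do. The named facts are the nodes of the DAG kept in the
owning literature unit's `NOTES.md` (étale invariance of `branchOrder`, closedness and regularity
of the top stratum, the chart computation for the blow-up of a regular local ring along part of a
regular system of parameters, flat base change of blow-ups).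
-/

noncomputable section

open CategoryTheory CategoryTheory.Limits AlgebraicGeometry TopologicalSpace

namespace Literature.AlgebraicGeometry.Resolution

universe u

/-! ## The number of branches of a closed subset at a point -/

/-- **Branch order** of the subset `Z ⊆ X` at the point `x`: the order
`ord_x(I) = sup {n | I_x ⊆ 𝔪_xⁿ} ∈ ℕ∞` (`idealOrder`) of the ideal sheaf `I = I_{closure Z}` of
the reduced closed subscheme carried by `closure Z` (Mathlib's `vanishingIdeal`). At a point of a
normal crossings divisor this is the number of geometric branches (étale-locally
`I_x = (x₁ ⋯ x_r)` with `xᵢ` part of a regular system of parameters has order `r`); it is `0` off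
`closure Z` and `≥ 1` on it. [folklore] -/
def branchOrder (X : Scheme.{u}) (Z : Set X) (x : X) : ℕ∞ :=
  idealOrder (Scheme.IdealSheafData.vanishingIdeal ⟨closure Z, isClosed_closure⟩) x

variable {X : Scheme.{u}} {Z : Set X} {x : X}

/-- Unfolding lemma for `branchOrder`. [folklore] -/
theorem branchOrder_def (X : Scheme.{u}) (Z : Set X) (x : X) :
    branchOrder X Z x =
      idealOrder (Scheme.IdealSheafData.vanishingIdeal ⟨closure Z, isClosed_closure⟩) x :=
  rfl

/-- The branch order is `≥ 1` exactly on the closure of `Z` (the support of the vanishing ideal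
sheaf of `closure Z` is `closure Z`). [folklore] -/
theorem one_le_branchOrder_iff : 1 ≤ branchOrder X Z x ↔ x ∈ closure Z := by
  rw [branchOrder, one_le_idealOrder_iff]
  change x ∈ ((Scheme.IdealSheafData.vanishingIdeal
    (⟨closure Z, isClosed_closure⟩ : Closeds X)).support : Set X) ↔ _
  simp

/-- On `Z` the branch order is at least one. [folklore] -/
theorem one_le_branchOrder (hx : x ∈ Z) : 1 ≤ branchOrder X Z x :=
  one_le_branchOrder_iff.mpr (subset_closure hx)

/-- Off the closure of `Z` the branch order vanishes. [folklore] -/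
theorem branchOrder_eq_zero (hx : x ∉ closure Z) : branchOrder X Z x = 0 := by
  by_contra h
  exact hx (one_le_branchOrder_iff.mp (Order.one_le_iff_ne_zero.mpr h))

/-- If `F ⊆ Z` with `F` closed and the branch order of `Z` is bounded by that of `F` at every
point of `Z`, then `Z = F`: at a point of `Z ∖ F` the left side is `≥ 1` and the right side is
`0`. (The end of the induction: no unmarked branches are left.) [folklore] -/
theorem eq_of_subset_of_branchOrder_le {F : Set X} (hF : IsClosed F) (hFZ : F ⊆ Z)
    (h : ∀ x ∈ Z, branchOrder X Z x ≤ branchOrder X F x) : Z = F := by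
  refine Set.Subset.antisymm (fun x hx => ?_) hFZ
  by_contra hxF
  have h1 := (one_le_branchOrder hx).trans (h x hx)
  rw [branchOrder_eq_zero (by rwa [hF.closure_eq])] at h1
  exact absurd h1 (by norm_num)

/-! ## The two named facts -/

/-- NAMED FACT — **the number of branches of a normal crossings divisor at a point is at most the
dimension of the local ring** (folklore, after de Jong 1996, 2.4 and Stacks 0BI9): for a normal
crossings divisor `Z` (`IsNormalCrossingsDivisor`: some surjective étale `e : S' → S` pulls `Z`
back to a strict normal crossings divisor) on a locally Noetherian scheme `S` and `s ∈ Z`,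
`branchOrder S Z s ≤ dim 𝒪_{S,s}`. Reason: for `s' ↦ s`, `𝒪_{S,s} → 𝒪_{S',s'}` is a flat,
unramified local homomorphism, so it preserves orders of ideals and dimension, and carries the
(radical) ideal of `Z` at `s` onto the ideal `(x₁ ⋯ x_r)` of `e⁻¹(Z)` at `s'`, whose order is
`r ≤ r + e = dim 𝒪_{S',s'}`. A node of the decomposition of `DeJong1996NormalCrossingsBlowup`;
users take `(h : NormalCrossingsBranchOrderLe)`. [cite: DeJong1996, 2.4, p. 55] -/
def NormalCrossingsBranchOrderLe : Prop :=
  ∀ (S : Scheme.{u}) [IsLocallyNoetherian S] (Z : Set S), IsNormalCrossingsDivisor S Z →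
    ∀ s ∈ Z, (branchOrder S Z s : WithBot ℕ∞) ≤ ringKrullDim (S.presheaf.stalk s)

/-- NAMED FACT — **one round of de Jong's recipe for making a normal crossings divisor strict**
(de Jong 1996, 2.4, parenthetical: "In case `S` is a surface, blow up the singular points of `D`;
in case `S` is a threefold, first blow up the points where `D` has three branches, then blow up
the strict transform of the curves on `S` where `D` has two branches, etc."), in the following
invariant form. Let `S` be a Noetherian scheme, `Z ⊆ S` a normal crossings divisor
(`IsNormalCrossingsDivisor`), `F ⊆ Z` a strict normal crossings divisor
(`IsStrictNormalCrossingsDivisor`; the "marked" part: `F` is then a union of components of `Z`,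
each regular), and `m : ℕ` such that at every `s ∈ Z` at most `m + 1` branches of `Z` are not
branches of `F`: `branchOrder S Z s ≤ branchOrder S F s + (m + 1)`. Then there are a blowing up
`φ : S₁ → S` of `S` in an ideal sheaf `I` (`IsBlowup φ I`) with `Supp(𝒪_S/I) ⊆ Z` and a strict
normal crossings divisor `F₁ ⊆ φ⁻¹(Z)` on `S₁` such that `φ⁻¹(Z)` is a normal crossings divisor on
`S₁` all of whose points lie on at most `m` branches that are not branches of `F₁`. (Proof, to be
discharged in sibling files: `I` is the ideal of the reduced closed subscheme
`C = {s ∈ Z | branchOrder S Z s = branchOrder S F s + m + 1}` — closed, regular, of pure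
codimension `m + 1`, étale-locally the coordinate subspace `x₁ = … = x_{m+1} = 0` where
`Z = V(x₁ ⋯ x_r)`, `F = V(x_{m+2} ⋯ x_r)` — and `F₁ = φ⁻¹(F ∪ C)`; the claims are the chart
computation for the blowing up of a regular local ring along `(x₁, …, x_{m+1})`, transported
along the étale cover by flat base change of blowing ups. For `F = ∅` on a surface, `C` is the set
of singular points of `Z`; on a threefold the two rounds blow up the triple points and then the
strict transform of the double curves.) A node of the decomposition of
`DeJong1996NormalCrossingsBlowup`; users take `(h : DeJong1996NormalCrossingsBlowupStep)`.
[cite: DeJong1996, 2.4, p. 55] -/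
def DeJong1996NormalCrossingsBlowupStep : Prop :=
  ∀ (S : Scheme.{u}) [IsNoetherian S] (Z F : Set S) (m : ℕ),
    IsNormalCrossingsDivisor S Z → IsStrictNormalCrossingsDivisor S F → F ⊆ Z →
      (∀ s ∈ Z, branchOrder S Z s ≤ branchOrder S F s + (m + 1 : ℕ)) →
        ∃ (S₁ : Scheme.{u}) (φ : S₁ ⟶ S) (I : S.IdealSheafData) (F₁ : Set S₁),
          IsBlowup φ I ∧ (I.support : Set S) ⊆ Z ∧
            IsNormalCrossingsDivisor S₁ (φ ⁻¹' Z) ∧ IsStrictNormalCrossingsDivisor S₁ F₁ ∧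
              F₁ ⊆ φ ⁻¹' Z ∧
                ∀ s ∈ φ ⁻¹' Z, branchOrder S₁ (φ ⁻¹' Z) s ≤ branchOrder S₁ F₁ s + m

/-! ## Bookkeeping: Noetherian sources of blow-ups, dimension of local rings -/

/-- The source of a blowing up of a Noetherian scheme is Noetherian: the blowing up is proper
(`IsBlowup.isProper`), so locally of finite type (locally Noetherian source) and quasi-compact
(quasi-compact source). [folklore] -/
theorem isNoetherian_of_isBlowup {S₁ S : Scheme.{u}} [IsNoetherian S] {φ : S₁ ⟶ S}
    {I : S.IdealSheafData} (hφ : IsBlowup φ I) : IsNoetherian S₁ := by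
  haveI : IsProper φ := hφ.isProper
  haveI : IsLocallyNoetherian S₁ := LocallyOfFiniteType.isLocallyNoetherian φ
  haveI : CompactSpace S₁ := QuasiCompact.compactSpace_of_compactSpace φ
  exact {}

/-- `dim 𝒪_{X,x} ≤ dim X` for every point of every scheme (`dim X = sup_x dim 𝒪_{X,x}`,
Görtz–Wedhorn I, Lemma 5.7 (4)). [folklore] -/
theorem ringKrullDim_stalk_le_topologicalKrullDim (X : Scheme.{u}) (x : X) :
    ringKrullDim (X.presheaf.stalk x) ≤ topologicalKrullDim X := by
  rw [Literature.AlgebraicGeometry.Motives.Scheme.topologicalKrullDim_eq_iSup_ringKrullDim_stalk]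
  exact le_iSup (fun x : X => ringKrullDim (X.presheaf.stalk x)) x

/-! ## The induction -/

/-- **The induction of de Jong 1996, 2.4** (given the step): for a Noetherian `S`, a normal
crossings divisor `Z`, a strict normal crossings divisor `F ⊆ Z` and `m` with
`branchOrder Z ≤ branchOrder F + m` on `Z`, some blowing up of `S` in an ideal supported in `Z`
has `φ⁻¹(Z)` a strict normal crossings divisor. Induction on `m`: for `m = 0` the bound forces
`Z = F` (`eq_of_subset_of_branchOrder_le`) and the identity (the blowing up in `𝒪_S`) will do;
for `m + 1` apply the step and then the induction hypothesis on the (Noetherian) blown-up scheme,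
and compose the two blowing ups (`IsBlowup.exists_isBlowup_comp_supported`).
[cite: DeJong1996, 2.4, p. 55] -/
theorem exists_isBlowup_isStrictNormalCrossingsDivisor_of_branchOrder_le
    (hstep : DeJong1996NormalCrossingsBlowupStep.{u}) (m : ℕ) :
    ∀ (S : Scheme.{u}) [IsNoetherian S] (Z F : Set S), IsNormalCrossingsDivisor S Z →
      IsStrictNormalCrossingsDivisor S F → F ⊆ Z →
        (∀ s ∈ Z, branchOrder S Z s ≤ branchOrder S F s + m) →
          ∃ (S' : Scheme.{u}) (φ : S' ⟶ S) (I : S.IdealSheafData), IsBlowup φ I ∧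
            (I.support : Set S) ⊆ Z ∧ IsStrictNormalCrossingsDivisor S' (φ ⁻¹' Z) := by
  induction m with
  | zero =>
    intro S _ Z F hZ hF hFZ hb
    have hZF : Z = F :=
      eq_of_subset_of_branchOrder_le hF.isClosed hFZ fun s hs => by simpa using hb s hs
    refine ⟨S, 𝟙 S, ⊤, isBlowup_id_top S, ?_, ?_⟩
    · rw [Scheme.IdealSheafData.support_top]
      exact Set.empty_subset _
    · have : ((𝟙 S : S ⟶ S) ⁻¹' Z : Set S) = Z := by ext; simp
      rw [this, hZF]
      exact hF
  | succ m ih =>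
    intro S _ Z F hZ hF hFZ hb
    obtain ⟨S₁, φ, I, F₁, hφ, hIZ, hZ₁, hF₁, hF₁Z, hb₁⟩ := hstep S Z F m hZ hF hFZ hb
    haveI : IsNoetherian S₁ := isNoetherian_of_isBlowup hφ
    obtain ⟨S₂, ψ, J, hψ, hJ, hsnc⟩ := ih S₁ (φ ⁻¹' Z) F₁ hZ₁ hF₁ hF₁Z hb₁
    obtain ⟨Q, hQ, hQZ⟩ := IsBlowup.exists_isBlowup_comp_supported φ I ψ J Z hφ hIZ hψ hJ
    refine ⟨S₂, ψ ≫ φ, Q, hQ, hQZ, ?_⟩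
    have : ((ψ ≫ φ) ⁻¹' Z : Set S₂) = ψ ⁻¹' (φ ⁻¹' Z) := by ext; simp
    rw [this]
    exact hsnc

/-- **de Jong 1996, 2.4 from its recipe**: the bound on the number of branches
(`NormalCrossingsBranchOrderLe`) and one round of blowing up the top stratum
(`DeJong1996NormalCrossingsBlowupStep`) give `DeJong1996NormalCrossingsBlowup` — a normal
crossings divisor on a Noetherian scheme of dimension `≤ d` becomes a strict normal crossings
divisor after a blowing up in an ideal supported in it. Start the induction
(`exists_isBlowup_isStrictNormalCrossingsDivisor_of_branchOrder_le`) with `F = ∅` and `m = d`: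
`branchOrder Z s ≤ dim 𝒪_{S,s} ≤ dim S ≤ d`. [cite: DeJong1996, 2.4, p. 55] -/
theorem DeJong1996NormalCrossingsBlowup.of_branchOrderLe_of_step
    (hle : NormalCrossingsBranchOrderLe.{u}) (hstep : DeJong1996NormalCrossingsBlowupStep.{u}) :
    DeJong1996NormalCrossingsBlowup.{u} := by
  intro S _ d hd D hD
  refine exists_isBlowup_isStrictNormalCrossingsDivisor_of_branchOrder_le hstep d S D ∅ hD
    (IsStrictNormalCrossingsDivisor.empty S) (Set.empty_subset D) fun s hs => ?_
  have h1 : (branchOrder S D s : WithBot ℕ∞) ≤ d :=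
    ((hle S D hD s hs).trans (ringKrullDim_stalk_le_topologicalKrullDim S s)).trans hd
  have h2 : branchOrder S D s ≤ d := by exact_mod_cast h1
  exact h2.trans le_add_self

end Literature.AlgebraicGeometry.Resolution

end
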